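import Mathlib
import Summits.MatrixMultiplication.MatrixMultiplication.Theorems.FidelityWitnessesFidelityThesisSepMajorantSingleProduct

/-!
# Line `separable-majorant` for crux `FidelityWitnesses.FidelityThesis` (stmt-MatrixMultiplication-4956) —
stub `stub_productFrameN`: an ORTHONORMAL BASIS OF THE PRODUCT SPAN, with coordinates both ways

Slots `b, c : Fin n × Fin n` (`P := Fin n × Fin n`), `⟨x, y⟩ = Σ_{b,c} conj x · y` on `ℂ^P ⊗ ℂ^P`.

Statement.  For `r` products `x_l(b, c) = u_l(b) · v_l(c)` (`l < r`) there are `d ≤ r` tensors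
`e_1, …, e_d ∈ ℂ^P ⊗ ℂ^P`, orthonormal for `⟨·,·⟩` (`Σ_{b,c} conj (e_s b c) · e_t b c = δ_{st}`), and
coefficients `co : Fin r → Fin d → ℂ`, `co' : Fin d → Fin r → ℂ` with

  `x_l = Σ_s co l s · e_s`   and   `e_s = Σ_l co' s l · x_l`,

i.e. an orthonormal basis of `E = span{u_l ⊗ v_l}` read coordinatewise, together with the change of
coordinates in both directions (the general-`(n, r)` form of the `n = 2, r = 6` product frame).

Proof.  Inside `H = EuclideanSpace ℂ (P × P)` let `W = span{x_l}`; `d := finrank W ≤ r`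
(`finrank_range_le_card`).  Take `ob := stdOrthonormalBasis ℂ W` and `e_s := ob s` read at `(b, c)`:
orthonormality is `orthonormal_iff_ite` unfolded through `Submodule.coe_inner` / `PiLp.inner_apply`;
`co l s := ⟪ob s, x_l⟫` from `OrthonormalBasis.sum_repr'` evaluated at `(b, c)`; and `co' s` from
`Submodule.mem_span_range_iff_exists_fun` (each `ob s ∈ W = span (range x)`) evaluated at `(b, c)`.
Supports item `stmt-MatrixMultiplication-4956`; no definitions; imports toolkit I only.
-/

namespace Summit.MatrixMultiplication.MatrixMultiplication.Theorems

open scoped BigOperators ComplexConjugate InnerProductSpace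
open Literature.Computability.AlgebraicComplexity Module

/-- **Orthonormal basis of the product span, with coordinates both ways.**  For `r` products
`u_l ⊗ v_l ∈ ℂ^{n×n} ⊗ ℂ^{n×n}` there are `d ≤ r` tensors `e_s`, orthonormal for
`⟨x, y⟩ = Σ_{b,c} conj x · y`, with `u_l ⊗ v_l = Σ_s co l s · e_s` and `e_s = Σ_l co' s l · (u_l ⊗ v_l)` — an
orthonormal basis of `span{u_l ⊗ v_l} ≤ EuclideanSpace ℂ ((Fin n × Fin n) × (Fin n × Fin n))`, read
coordinatewise. [folklore] -/
theorem stub_productFrameN {n r : ℕ} (u v : Fin r → Fin n × Fin n → ℂ) :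
    ∃ (d : ℕ) (e : Fin d → Fin n × Fin n → Fin n × Fin n → ℂ) (co : Fin r → Fin d → ℂ)
      (co' : Fin d → Fin r → ℂ),
      d ≤ r ∧
      (∀ s t : Fin d, (∑ b, ∑ c, conj (e s b c) * e t b c) = if s = t then 1 else 0) ∧
      (∀ (l : Fin r) (b c : Fin n × Fin n), u l b * v l c = ∑ s, co l s * e s b c) ∧
      (∀ (s : Fin d) (b c : Fin n × Fin n), e s b c = ∑ l, co' s l * (u l b * v l c)) := by
  -- adapted from `sepMajorantTM_orthonormalCoordinates`
  -- (Theorems/FidelityWitnessesFidelityThesisStubTrivialMajorant) and `flatteningWitness_proof`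
  -- (Theorems/FidelityWitnessesFlatteningWitness): span, `stdOrthonormalBasis`,
  -- `OrthonormalBasis.sum_repr'` / `Submodule.mem_span_range_iff_exists_fun` read coordinatewise
  let x : Fin r → EuclideanSpace ℂ ((Fin n × Fin n) × (Fin n × Fin n)) :=
    fun l => WithLp.toLp 2 (fun p => u l p.1 * v l p.2)
  let W : Submodule ℂ (EuclideanSpace ℂ ((Fin n × Fin n) × (Fin n × Fin n))) :=
    Submodule.span ℂ (Set.range x)
  have hmem : ∀ l, x l ∈ W := fun l => Submodule.subset_span ⟨l, rfl⟩
  have hd : finrank ℂ W ≤ r := (finrank_range_le_card x).trans (by rw [Fintype.card_fin])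
  let ob : OrthonormalBasis (Fin (finrank ℂ W)) ℂ W := stdOrthonormalBasis ℂ W
  obtain ⟨e, he⟩ : ∃ e : Fin (finrank ℂ W) → Fin n × Fin n → Fin n × Fin n → ℂ, ∀ s b c,
      e s b c = ((ob s : W) : EuclideanSpace ℂ ((Fin n × Fin n) × (Fin n × Fin n))) (b, c) :=
    ⟨_, fun _ _ _ => rfl⟩
  obtain ⟨co, hco⟩ : ∃ co : Fin r → Fin (finrank ℂ W) → ℂ, ∀ l s,
      co l s = ⟪((ob s : W) : EuclideanSpace ℂ ((Fin n × Fin n) × (Fin n × Fin n))), x l⟫_ℂ :=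
    ⟨_, fun _ _ => rfl⟩
  -- each basis vector lies in `W = span (range x)`: coordinates in terms of the products
  have hspan : ∀ s : Fin (finrank ℂ W), ∃ cs : Fin r → ℂ,
      ∑ l, cs l • x l = ((ob s : W) : EuclideanSpace ℂ ((Fin n × Fin n) × (Fin n × Fin n))) :=
    fun s => (Submodule.mem_span_range_iff_exists_fun ℂ).mp (ob s).2
  choose co' hco' using hspan
  refine ⟨finrank ℂ W, e, co, co', hd, ?_, ?_, ?_⟩
  · -- orthonormality, read coordinatewise
    intro s t
    have h := orthonormal_iff_ite.mp ob.orthonormal s t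
    rw [Submodule.coe_inner, PiLp.inner_apply] at h
    rw [← h, Fintype.sum_prod_type (α₁ := Fin n × Fin n) (α₂ := Fin n × Fin n)]
    exact Finset.sum_congr rfl fun b _ => Finset.sum_congr rfl fun c _ => by
      rw [he, he, RCLike.inner_apply']
  · -- the products in the basis
    intro l b c
    have hx := ob.sum_repr' ⟨x l, hmem l⟩
    have hx' := congrArg
      (fun y : W => (y : EuclideanSpace ℂ ((Fin n × Fin n) × (Fin n × Fin n))) (b, c)) hx
    simp only [Submodule.coe_sum, Submodule.coe_smul, WithLp.ofLp_sum, WithLp.ofLp_smul,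
      Finset.sum_apply, Pi.smul_apply, smul_eq_mul, Submodule.coe_inner] at hx'
    calc u l b * v l c = _ := hx'.symm
      _ = ∑ s, co l s * e s b c := Finset.sum_congr rfl fun s _ => by rw [hco, he]
  · -- the basis in the products
    intro s b c
    have h := congrArg
      (fun y : EuclideanSpace ℂ ((Fin n × Fin n) × (Fin n × Fin n)) => y (b, c)) (hco' s)
    simp only [WithLp.ofLp_sum, WithLp.ofLp_smul, Finset.sum_apply, Pi.smul_apply,
      smul_eq_mul] at h
    rw [he, ← h]

end Summit.MatrixMultiplication.MatrixMultiplication.Theorems
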